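import Summits.Ventures.PercRepro.C041TriDomExcessConvWalk

/-!
# ROW C-041 — THE EQUALITY CASE OF THE EXCESS, X: NON-SEPARABLE STATUSES AND THE REDUCTION LEMMA
(p6, gen 44; P6-TWOEXIT-LEAN.md §53 ADDENDUM 11, part II of III)

A status `st` is NON-SEPARABLE for the marks `x, y, z` (`NonSep st x y z`) if the double-classes of the marks are
pairwise distinct and each pair of marks is joined by a present walk avoiding the class of the third — the
contracted host (double edges contracted, absent edges deleted) is connected on the marks and no mark separates the
other two.  The notion is symmetric in the marks (`NonSep.swap12`, `NonSep.swap23`).  `FreeJoin st f w x` says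
that the free edge `f` joins the class of `w` to the class of `x`; `Star st x y z` is a fourth class joined by free
edges to all three mark classes, `Tri st x y z` the three mark classes pairwise joined by free edges — the shapes
of `StarMinor` / `TriMinor` after the other free edges are deleted (part III).

**THE REDUCTION LEMMA** (`NonSep.reduce`): if every free edge touches a mark class (`Touching`) and the classes of
`x` and `z` are not joined by a free edge, then the status is a star, or some free edge can be CONTRACTED keeping
the status non-separable.  PROOF: let `T` be the vertices reachable from `z` avoiding the classes of `x` and `y`;
the walk from `x` to `z` avoiding the class of `y` crosses into `T` by a present edge `v–w` (THE CROSSING LEMMA),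
`v` in the class of `x` (else `v ∈ T`), the edge free (double would put `w` in the class of `x`), `w` off all three
classes (in the class of `z` it would be a free edge `x–z`).  If the class of `w` has free edges to the classes of
`y` and of `z` as well, this is a star.  Otherwise contract `v–w`: the classes of `y` and `z` and the present edges
are unchanged, so the walks avoiding them transfer; the new class of `x` lies in the old class of `x` together with
the class of `w`, and the walk from `y` to `z` avoiding the class of `x` is re-routed around the class of `w` by THE
BYPASS LEMMA (every exit of that class off the class of `x` is a free edge into the class of `y` or of `z`, and by
the case assumption into only one of them, whose vertices are double-connected among themselves).  Contracting a
free edge with both ends off the mark classes always keeps non-separability (`NonSep.contract_off`).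
-/

namespace PercRepro

namespace ZoneZ

namespace MultiExit

open ZoneData Finset

variable {V₁ E₁ U₁ U₂ : Type} (Z₁ : ZoneData V₁ E₁ U₁ U₂)

/-! ## The vocabulary -/

/-- `w` is off the double-classes of the three marks. -/
def OffMarks (st : E₁ → EStat) (x y z w : V₁) : Prop :=
  ¬ DConn Z₁ st x w ∧ ¬ DConn Z₁ st y w ∧ ¬ DConn Z₁ st z w

/-- The free edge `f` joins the double-class of `w` to the double-class of `x`. -/
def FreeJoin (st : E₁ → EStat) (f : E₁) (w x : V₁) : Prop :=
  st f = .free ∧ ∃ p q, Z₁.Joins f p q ∧ DConn Z₁ st w p ∧ DConn Z₁ st x q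

/-- A STAR: a vertex off the mark classes whose class is joined by free edges to all three mark classes. -/
def Star (st : E₁ → EStat) (x y z : V₁) : Prop :=
  ∃ w, OffMarks Z₁ st x y z w ∧ (∃ f, FreeJoin Z₁ st f w x) ∧ (∃ f, FreeJoin Z₁ st f w y) ∧
    (∃ f, FreeJoin Z₁ st f w z)

/-- A TRIANGLE: the three mark classes pairwise joined by free edges. -/
def Tri (st : E₁ → EStat) (x y z : V₁) : Prop :=
  (∃ f, FreeJoin Z₁ st f x y) ∧ (∃ f, FreeJoin Z₁ st f x z) ∧ (∃ f, FreeJoin Z₁ st f y z)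

/-- Every free edge touches a mark class. -/
def Touching (st : E₁ → EStat) (x y z : V₁) : Prop :=
  ∀ f, st f = .free → ∀ p q, Z₁.Joins f p q → ¬ OffMarks Z₁ st x y z p ∨ ¬ OffMarks Z₁ st x y z q

/-- The status is NON-SEPARABLE for the marks `x, y, z`: their double-classes are pairwise distinct and each pair
of marks is joined by a present walk avoiding the class of the third. -/
structure NonSep (st : E₁ → EStat) (x y z : V₁) : Prop where
  nxy : ¬ DConn Z₁ st x y
  nxz : ¬ DConn Z₁ st x z
  nyz : ¬ DConn Z₁ st y z
  cx : PConnA Z₁ st (cls Z₁ st x) y z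
  cy : PConnA Z₁ st (cls Z₁ st y) x z
  cz : PConnA Z₁ st (cls Z₁ st z) x y

/-! ## Symmetry in the marks -/

/-- A vertex is off the mark classes or in one of them. -/
theorem not_offMarks {st : E₁ → EStat} {x y z t : V₁} (h : ¬ OffMarks Z₁ st x y z t) :
    DConn Z₁ st x t ∨ DConn Z₁ st y t ∨ DConn Z₁ st z t := by
  by_contra hc
  push Not at hc
  exact h ⟨hc.1, hc.2.1, hc.2.2⟩

/-- `OffMarks` with the first two marks exchanged. -/
theorem OffMarks.swap12 {st : E₁ → EStat} {x y z w : V₁} (h : OffMarks Z₁ st x y z w) : OffMarks Z₁ st y x z w :=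
  ⟨h.2.1, h.1, h.2.2⟩

/-- `OffMarks` with the last two marks exchanged. -/
theorem OffMarks.swap23 {st : E₁ → EStat} {x y z w : V₁} (h : OffMarks Z₁ st x y z w) : OffMarks Z₁ st x z y w :=
  ⟨h.1, h.2.2, h.2.1⟩

/-- A free join read from the other end. -/
theorem FreeJoin.symm {st : E₁ → EStat} {f : E₁} {w x : V₁} (h : FreeJoin Z₁ st f w x) : FreeJoin Z₁ st f x w := by
  obtain ⟨hf, p, q, hj, hw, hx⟩ := h
  exact ⟨hf, q, p, Joins_symm Z₁ hj, hx, hw⟩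

/-- `Star` with the first two marks exchanged. -/
theorem Star.swap12 {st : E₁ → EStat} {x y z : V₁} (h : Star Z₁ st x y z) : Star Z₁ st y x z := by
  obtain ⟨w, hw, h1, h2, h3⟩ := h
  exact ⟨w, hw.swap12, h2, h1, h3⟩

/-- `Star` with the last two marks exchanged. -/
theorem Star.swap23 {st : E₁ → EStat} {x y z : V₁} (h : Star Z₁ st x y z) : Star Z₁ st x z y := by
  obtain ⟨w, hw, h1, h2, h3⟩ := h
  exact ⟨w, hw.swap23, h1, h3, h2⟩

/-- `Touching` with the first two marks exchanged. -/
theorem Touching.swap12 {st : E₁ → EStat} {x y z : V₁} (h : Touching Z₁ st x y z) : Touching Z₁ st y x z := by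
  intro f hf p q hj
  rcases h f hf p q hj with hp | hq
  · exact Or.inl fun h' => hp h'.swap12
  · exact Or.inr fun h' => hq h'.swap12

/-- `Touching` with the last two marks exchanged. -/
theorem Touching.swap23 {st : E₁ → EStat} {x y z : V₁} (h : Touching Z₁ st x y z) : Touching Z₁ st x z y := by
  intro f hf p q hj
  rcases h f hf p q hj with hp | hq
  · exact Or.inl fun h' => hp h'.swap23
  · exact Or.inr fun h' => hq h'.swap23

/-- `NonSep` with the first two marks exchanged. -/
theorem NonSep.swap12 {st : E₁ → EStat} {x y z : V₁} (h : NonSep Z₁ st x y z) : NonSep Z₁ st y x z where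
  nxy := fun h' => h.nxy (DConn_symm Z₁ h')
  nxz := h.nyz
  nyz := h.nxz
  cx := h.cy
  cy := h.cx
  cz := PConnA_symm Z₁ h.cz

/-- `NonSep` with the last two marks exchanged. -/
theorem NonSep.swap23 {st : E₁ → EStat} {x y z : V₁} (h : NonSep Z₁ st x y z) : NonSep Z₁ st x z y where
  nxy := h.nxz
  nxz := h.nxy
  nyz := fun h' => h.nyz (DConn_symm Z₁ h')
  cx := PConnA_symm Z₁ h.cx
  cy := h.cz
  cz := h.cy

/-! ## Contracting an edge off the marks -/

variable [DecidableEq E₁]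

/-- Contracting a free edge with both ends off the mark classes keeps non-separability: the mark classes and the
present edges are unchanged. -/
theorem NonSep.contract_off {st : E₁ → EStat} {x y z : V₁} (h : NonSep Z₁ st x y z) {f : E₁} (hf : st f = .free)
    {p q : V₁} (hj : Z₁.Joins f p q) (hp : OffMarks Z₁ st x y z p) (hq : OffMarks Z₁ st x y z q) :
    NonSep Z₁ (Function.update st f .double) x y z := by
  have hcx := cls_update_double_of_not Z₁ hj hp.1 hq.1
  have hcy := cls_update_double_of_not Z₁ hj hp.2.1 hq.2.1
  have hcz := cls_update_double_of_not Z₁ hj hp.2.2 hq.2.2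
  have hP := PConnA_update_double Z₁ hf
  refine ⟨?_, ?_, ?_, ?_, ?_, ?_⟩
  · rw [DConn_update_double_of_not Z₁ hj hp.1 hq.1]; exact h.nxy
  · rw [DConn_update_double_of_not Z₁ hj hp.1 hq.1]; exact h.nxz
  · rw [DConn_update_double_of_not Z₁ hj hp.2.1 hq.2.1]; exact h.nyz
  · rw [hcx, hP]; exact h.cx
  · rw [hcy, hP]; exact h.cy
  · rw [hcz, hP]; exact h.cz

/-! ## The reduction lemma -/

/-- **THE REDUCTION LEMMA**: if every free edge touches a mark class and the classes of `x` and `z` are not joined by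
a free edge, a non-separable status is a star, or some free edge contracts to a non-separable status. -/
theorem NonSep.reduce {st : E₁ → EStat} {x y z : V₁} (h : NonSep Z₁ st x y z) (hT : Touching Z₁ st x y z)
    (hxz : ¬ ∃ f, FreeJoin Z₁ st f x z) :
    Star Z₁ st x y z ∨ ∃ f, st f = .free ∧ NonSep Z₁ (Function.update st f .double) x y z := by
  -- the far side of the classes of `x` and `y`, seen from `z`
  have hzS : z ∉ cls Z₁ st x ∪ cls Z₁ st y := by
    simp only [Set.mem_union, mem_cls, not_or]
    exact ⟨h.nxz, h.nyz⟩
  have hxT : ¬ PConnA Z₁ st (cls Z₁ st x ∪ cls Z₁ st y) z x := fun hx =>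
    PConnA_not_mem Z₁ hx hzS (Or.inl (DConn_refl Z₁ st x))
  have hzT : PConnA Z₁ st (cls Z₁ st x ∪ cls Z₁ st y) z z := PConnA_refl Z₁ st _ z
  -- the crossing edge `v–w`
  obtain ⟨v, w, hvw, hvT, hwT⟩ :=
    rtg_crossing (P := fun t => PConnA Z₁ st (cls Z₁ st x ∪ cls Z₁ st y) z t) h.cy hxT hzT
  obtain ⟨⟨e, hj, hpres⟩, hvy, hwy⟩ := hvw
  have hwS : w ∉ cls Z₁ st x ∪ cls Z₁ st y := PConnA_not_mem Z₁ hwT hzS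
  have hwx : ¬ DConn Z₁ st x w := fun h' => hwS (Or.inl h')
  have hyw : ¬ DConn Z₁ st y w := fun h' => hwS (Or.inr h')
  -- `v` lies in the class of `x`
  have hvx : DConn Z₁ st x v := by
    by_contra hvx
    apply hvT
    refine PConnA_trans Z₁ hwT (Relation.ReflTransGen.single ⟨⟨e, Joins_symm Z₁ hj, hpres⟩, hwS, ?_⟩)
    simp only [Set.mem_union, mem_cls, not_or]
    exact ⟨hvx, hvy⟩
  -- the crossing edge is free
  have hefree : st e = .free := by
    rcases hs : st e with _ | _ | _
    · rfl
    · exact absurd hs hpres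
    · exact absurd (DConn_trans Z₁ hvx (DConn_of_dblE Z₁ hs hj)) hwx
  -- `w` is off the class of `z` as well
  have hwz : ¬ DConn Z₁ st z w := fun hzw => hxz ⟨e, hefree, v, w, hj, hvx, hzw⟩
  have hwoff : OffMarks Z₁ st x y z w := ⟨hwx, hyw, hwz⟩
  by_cases hstar : (∃ f, FreeJoin Z₁ st f w y) ∧ (∃ f, FreeJoin Z₁ st f w z)
  · exact Or.inl ⟨w, hwoff, ⟨e, hefree, w, v, Joins_symm Z₁ hj, DConn_refl Z₁ st w, hvx⟩, hstar.1, hstar.2⟩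
  refine Or.inr ⟨e, hefree, ?_⟩
  have hyv : ¬ DConn Z₁ st y v := fun h' => h.nxy (DConn_trans Z₁ hvx (DConn_symm Z₁ h'))
  have hzv : ¬ DConn Z₁ st z v := fun h' => h.nxz (DConn_trans Z₁ hvx (DConn_symm Z₁ h'))
  have hcy : cls Z₁ (Function.update st e .double) y = cls Z₁ st y := cls_update_double_of_not Z₁ hj hyv hyw
  have hcz : cls Z₁ (Function.update st e .double) z = cls Z₁ st z := cls_update_double_of_not Z₁ hj hzv hwz
  have hP := PConnA_update_double Z₁ hefree
  -- the boundary of the class of `w`, off the class of `x`, lies in the class of `y` or of `z`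
  have hbd : ∀ t, t ∉ cls Z₁ st x → t ∉ cls Z₁ st w → (∃ c ∈ cls Z₁ st w, PAdjS Z₁ st c t) →
      ((∃ f, FreeJoin Z₁ st f w y) ∧ DConn Z₁ st y t) ∨ ((∃ f, FreeJoin Z₁ st f w z) ∧ DConn Z₁ st z t) := by
    rintro t htx htw ⟨c, hc, e', hj', hpres'⟩
    rw [mem_cls] at hc htx htw
    have hfree' : st e' = .free := by
      rcases hs : st e' with _ | _ | _
      · rfl
      · exact absurd hs hpres'
      · exact absurd (DConn_trans Z₁ hc (DConn_of_dblE Z₁ hs hj')) htw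
    have hcoff : OffMarks Z₁ st x y z c :=
      ⟨fun h' => hwx (DConn_trans Z₁ h' (DConn_symm Z₁ hc)), fun h' => hyw (DConn_trans Z₁ h' (DConn_symm Z₁ hc)),
        fun h' => hwz (DConn_trans Z₁ h' (DConn_symm Z₁ hc))⟩
    rcases hT e' hfree' c t hj' with hnc | hnt
    · exact absurd hcoff hnc
    · rcases not_offMarks Z₁ hnt with h1 | h1 | h1
      · exact absurd h1 htx
      · exact Or.inl ⟨⟨e', hfree', c, t, hj', hc, h1⟩, h1⟩
      · exact Or.inr ⟨⟨e', hfree', c, t, hj', hc, h1⟩, h1⟩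
  refine ⟨?_, ?_, ?_, ?_, ?_, ?_⟩
  · intro h'
    have h'' := DConn_symm Z₁ h'
    rw [DConn_update_double_of_not Z₁ hj hyv hyw] at h''
    exact h.nxy (DConn_symm Z₁ h'')
  · intro h'
    have h'' := DConn_symm Z₁ h'
    rw [DConn_update_double_of_not Z₁ hj hzv hwz] at h''
    exact h.nxz (DConn_symm Z₁ h'')
  · intro h'
    rw [DConn_update_double_of_not Z₁ hj hyv hyw] at h'
    exact h.nyz h'
  · rw [hP]
    refine PConnA_mono Z₁ (S' := cls Z₁ st x ∪ cls Z₁ st w) ?_ ?_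
    · intro t ht
      rw [mem_cls] at ht
      rcases DConn_update_double_sub Z₁ hj hwx ht with h1 | h1
      · exact Or.inl h1
      · exact Or.inr h1
    · have hyw' : y ∉ cls Z₁ st w := fun h' => hyw (DConn_symm Z₁ h')
      have hzw' : z ∉ cls Z₁ st w := fun h' => hwz (DConn_symm Z₁ h')
      refine rtg_bypass (R := PAdjS Z₁ st) (fun a b hab => AdjCol_symm Z₁ _ _ _ hab) (cls Z₁ st x) (cls Z₁ st w)
        ?_ hyw' hzw' h.cx
      intro t t' htS htC ht'S ht'C hct hct'
      rcases hbd t htS htC hct with ⟨hfy, hyt⟩ | ⟨hfz, hzt⟩ <;>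
        rcases hbd t' ht'S ht'C hct' with ⟨hfy', hyt'⟩ | ⟨hfz', hzt'⟩
      · refine PConnA_of_DConn Z₁ (DConn_of_mem_cls Z₁ hyt hyt') fun w' hw' => ?_
        have hyw'' : DConn Z₁ st y w' := DConn_trans Z₁ hyt hw'
        simp only [Set.mem_union, mem_cls, not_or]
        exact ⟨fun hx' => h.nxy (DConn_trans Z₁ hx' (DConn_symm Z₁ hyw'')),
          fun hw'' => hyw (DConn_trans Z₁ hyw'' (DConn_symm Z₁ hw''))⟩
      · exact absurd ⟨hfy, hfz'⟩ hstar
      · exact absurd ⟨hfy', hfz⟩ hstar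
      · refine PConnA_of_DConn Z₁ (DConn_of_mem_cls Z₁ hzt hzt') fun w' hw' => ?_
        have hzw'' : DConn Z₁ st z w' := DConn_trans Z₁ hzt hw'
        simp only [Set.mem_union, mem_cls, not_or]
        exact ⟨fun hx' => h.nxz (DConn_trans Z₁ hx' (DConn_symm Z₁ hzw'')),
          fun hw'' => hwz (DConn_trans Z₁ hzw'' (DConn_symm Z₁ hw''))⟩
  · rw [hcy, hP]; exact h.cy
  · rw [hcz, hP]; exact h.cz

end MultiExit

end ZoneZ

end PercRepro
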